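import Summits.AtomisticToContinuum.HydrodynamicLimit.Theorems.ImplosionDichotomyHydroLimitInBandWindowClause
import Summits.AtomisticToContinuum.HydrodynamicLimit.Theorems.ImplosionDichotomyHydroLimitInBandStaticClause
import Summits.AtomisticToContinuum.HydrodynamicLimit.Theorems.ImplosionDichotomyHydroLimitInBandWindowContinuity
import Summits.AtomisticToContinuum.HydrodynamicLimit.Theorems.ImplosionDichotomyHydroLimitInBandActivityTailsOfTransfer
import Summits.AtomisticToContinuum.HydrodynamicLimit.Theses.TwoClocks
import Summits.AtomisticToContinuum.HydrodynamicLimit.Theorems.ImplosionDichotomyProfilewiseOfInBand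
import HarnessLib

/-!
# The glued split of the crux `HydroLimitInBand` into the five inputs of line `IdeatorOneSketch`
# (stmt-AtomisticToContinuum-9133; route ImplosionDichotomy; text: crux-strategist `planner-cstrat-stmt-AtomisticToContinuum-9133-s1-0`,
# landed by lead c7 after the OfHeart repair p135796; the LaxScheme-typed variants are gone with route LaxScheme rev 5)

Support file (`--supports stmt-AtomisticToContinuum-9133`). With the two clauses of the shared one-window heart LANDED —
`HydroLimitInBandHeart.stub_staticClause : StaticClauseInBand` (p123605) and `HydroLimitInBandHeart.stub_windowClause : WindowClause`
(p127017, lead c3) — the registered skeleton `Cruxes/HydroLimitInBand/Lines/IdeatorOneSketch.lean` (v11) has ONE open stub,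
`stub_inputs : LineInputs` (six conjecture-grade inputs, not attacked by the line). This file records in the tree

* `oneWindowLedger_holds : OneWindowLedger` — the shared heart, sorry-free (the v11 glue `oneWindowLedgerStatic_of_clauses`,
  adapted verbatim from the skeleton, over the two landed clauses);
* `hydroLimitInBand_of_lineInputs : LineInputs → ImplosionDichotomy.HydroLimitInBand` — the line's end state;
* `HydroLimitInBand_of_subs` — THE GLUE OF THE ROUTE-LEVEL SPLIT of the crux into FIVE children, typed over EXISTING decls so
  that three of them deduplicate onto staffed items: `OneFlightGossipEngine.KineticCurrentsLDAlongFamilies` (stmt-16659, =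
  KCWU along families, `Iff.rfl` with the line's `KineticCurrentsWindowLDFamily`), `HydroLimitInBandOfHeart.LocalClampedTransferWindowLDFamily`
  (new item), `HydroLimitInBandOfHeart.CoherentSuprathermalContentVanishesW` (new item), `TwoClocks.TransferActivityTails`
  (stmt-16624; it implies CAT 13734 ∧ CEAT by the landed `HydroLimitInBandHeart.activityTails_of_transferActivityTails`) and
  `OneFlightGossipEngine.EnergyCurrentTails` (stmt-9235).

Everything here is quantifier plumbing over landed theorems; the mathematics is the leads' (9133 -0/c1/c2/c3/c4) and the
sibling 14680 leads'. [cite: Yau1991, §2; OllaVaradhanYau1993, §3]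
-/

noncomputable section

open MeasureTheory Filter Set Topology InformationTheory
open scoped ENNReal

namespace Summit.AtomisticToContinuum.HydrodynamicLimit.Theorems.HydroLimitInBandSplit

open Literature.MathematicalPhysics.KineticTheory Literature.Analysis.FluidPDE Literature.Analysis.FunctionSpaces
open Summit.AtomisticToContinuum.HydrodynamicLimit.Theses
open Summit.AtomisticToContinuum.HydrodynamicLimit.Theorems
open Summit.AtomisticToContinuum.HydrodynamicLimit.Theorems.ClampedCurrentsDockFromWindows (OneWindowLedgerStatic)
open Summit.AtomisticToContinuum.HydrodynamicLimit.Theorems.HydroLimitInBandOfHeart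
  (LocalClampedTransferWindowLDFamily CollisionEnergyActivityTails CoherentSuprathermalContentVanishesW KineticCurrentsWindowLDFamily
    LineInputs OneWindowLedger hydroLimitInBand_of_heart)
open Summit.AtomisticToContinuum.HydrodynamicLimit.Theorems.HydroLimitInBandHeart
  (StaticClauseInBand WindowClauseInBand WindowClause stub_staticClause stub_windowClause activityTails_of_transferActivityTails)

/-! ## §1 The shared heart, sorry-free -/

/-- **The two landed clauses give `OneWindowLedgerStatic`** — `ηp := min ηs ηw`, `σ₀ := min σ_w (1/2)`, `K` from the window
clause, `Cst` the explicit centring. Adapted verbatim from `Cruxes/HydroLimitInBand/Lines/IdeatorOneSketch.lean` v11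
(`oneWindowLedgerStatic_of_clauses`, lead c3). [cite: Yau1991, §2] -/
theorem oneWindowLedgerStatic_of_clauses (hS : StaticClauseInBand) (hW : WindowClauseInBand) : OneWindowLedgerStatic := by
  intro r Rf hr hana hLip hsol hbd hcont huniq η₀ hη₀ HU
  obtain ⟨ηs, hηs, HS⟩ := hS r Rf hr hana hLip hsol hbd hcont huniq
  obtain ⟨ηw, hηw, HW⟩ := hW r Rf hr hana hLip hsol hbd hcont huniq η₀ hη₀ HU
  refine ⟨min ηs ηw, lt_min hηs hηw, fun a₀ θ₀ u₀ ha hθ hu ha0 hθ0 => ?_⟩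
  obtain ⟨σw, hσw, HWσ⟩ := HW a₀ θ₀ u₀ ha hθ hu ha0 hθ0
  refine ⟨min σw (1 / 2), lt_min hσw (by norm_num), fun σ hσ hσlt T ρ θ u hE hguard Φ htie t ht => ?_⟩
  have hσw' : σ < σw := hσlt.trans_le (min_le_left _ _)
  have hσ2 : σ < 1 / 2 := hσlt.trans_le (min_le_right _ _)
  have hgs : ∀ s ∈ Set.Ico 0 T, ∀ x, ρ s x * σ ^ 3 < ηs := fun s hs x =>
    (hguard s hs x).trans_le (min_le_left _ _)
  have hgw : ∀ s ∈ Set.Ico 0 T, ∀ x, ρ s x * σ ^ 3 < ηw := fun s hs x =>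
    (hguard s hs x).trans_le (min_le_right _ _)
  obtain ⟨hCst, hstat⟩ := HS a₀ θ₀ u₀ ha hθ hu ha0 hθ0 σ hσ hσ2 T ρ θ u hE hgs Φ htie t ht
  obtain ⟨K, hK, hwin⟩ := HWσ σ hσ hσw' T ρ θ u hE hgw Φ htie t ht
  exact ⟨K, hK, _, hCst, hstat, hwin⟩

/-- **THE SHARED HEART `OneWindowLedger`, sorry-free**: the registered `stub_oneWindowLedgerInBand` of stmt-9133 (= the retired
sibling 14680's `stub_oneWindowLedger`, same term) — a one-liner over the two LANDED clauses. [folklore] -/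
theorem oneWindowLedger_holds : OneWindowLedger :=
  fun h₁ h₂ h₃ h₄ h₅ h₆ h₇ h₈ h₉ h₁₀ =>
    oneWindowLedgerStatic_of_clauses stub_staticClause (stub_windowClause h₁ h₂ h₃ h₄ h₅ h₆ h₇ h₈ h₉ h₁₀)

/-! ## §2 The line's end state: the crux from its inputs -/

/-- **`LineInputs → HydroLimitInBand`** (the end state of line `IdeatorOneSketch`): the landed composition
`hydroLimitInBand_of_heart` (p122696) fed the sorry-free heart and the landed window continuity (p118327). [folklore] -/
theorem hydroLimitInBand_of_lineInputs (hI : LineInputs) : ImplosionDichotomy.HydroLimitInBand :=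
  hydroLimitInBand_of_heart oneWindowLedger_holds HydroLimitInBandContinuity.stub_windowContinuityInBand hI

/-! ## §3 The glue of the route-level split (five children) -/

/-- **GLUE OF THE SPLIT `HydroLimitInBand ⇐ KCWF, LCTF, CSCV-W, TAT, ECT`.** Children, in this order: the kinetic window LD along
families (stmt-16659's decl), the local transfer-clamped collisional window LD along families, the weighted coherent-suprathermal
input, the transfer-activity tails (stmt-16624's decl; splits into CAT ∧ CEAT by `activityTails_of_transferActivityTails`) and the
cubic energy-current tails (stmt-9235's decl). Pure bookkeeping over `hydroLimitInBand_of_lineInputs`. [folklore] -/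
theorem HydroLimitInBand_of_subs :
    OneFlightGossipEngine.KineticCurrentsLDAlongFamilies → LocalClampedTransferWindowLDFamily →
      CoherentSuprathermalContentVanishesW → TwoClocks.TransferActivityTails → OneFlightGossipEngine.EnergyCurrentTails →
      ImplosionDichotomy.HydroLimitInBand :=
  fun hK hL hC hT hE =>
    hydroLimitInBand_of_lineInputs
      ⟨hL, (activityTails_of_transferActivityTails hT).2, hC, hK, (activityTails_of_transferActivityTails hT).1, hE⟩

/-! ## §4 The same children close the binder of `closes` (stmt-17372, appended by lead c8 of stmt-9133, cycle 9) -/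

/-- **GLUE FOR THE BINDER OF `closes`: `HydroLimitProfilewiseBand ⇐ KCWF, LCTF, CSCV-W, TAT, ECT`.** Since route rev 11 the deciding
theorem is `closes (hD : DiluteSelfConsistency) (hP : HydroLimitProfilewiseBand)`, so the profile-wise band (stmt-AtomisticToContinuum-17372)
is the load-bearing node and `HydroLimitInBand` (stmt-9133, the Statement verbatim) sits above it through `profilewiseOfInBand_proof`
(stmt-17373). The five children of §3 therefore close EITHER node; this is the `--glue-by` decl for a route-level split of stmt-17372 into the
same children (the registered composition `HydroLimitProfilewiseBand_of` of `Cruxes/HydroLimitProfilewiseBand/Lines/IdeatorOneSketch.lean`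
is this two-liner). Pure bookkeeping. [folklore] -/
theorem HydroLimitProfilewiseBand_of_subs :
    OneFlightGossipEngine.KineticCurrentsLDAlongFamilies → LocalClampedTransferWindowLDFamily →
      CoherentSuprathermalContentVanishesW → TwoClocks.TransferActivityTails → OneFlightGossipEngine.EnergyCurrentTails →
      ImplosionDichotomy.HydroLimitProfilewiseBand :=
  fun hK hL hC hT hE => profilewiseOfInBand_proof (HydroLimitInBand_of_subs hK hL hC hT hE)

/-- **`LineInputs → HydroLimitProfilewiseBand`**: the end state of line `IdeatorOneSketch` read at the binder of `closes`. [folklore] -/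
theorem hydroLimitProfilewiseBand_of_lineInputs (hI : LineInputs) : ImplosionDichotomy.HydroLimitProfilewiseBand :=
  profilewiseOfInBand_proof (hydroLimitInBand_of_lineInputs hI)

end Summit.AtomisticToContinuum.HydrodynamicLimit.Theorems.HydroLimitInBandSplit

end
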